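import Literature.MathematicalPhysics.QuantumFieldTheory.Balaban1983to89.B13OpsYPencilTransport

/-!
# `Balaban1983to89.B13OpsYPencilDeltaPrime` — T. Bałaban, *Propagators for lattice gauge theories in a background field*, Commun. Math. Phys. **99** (1985)
# 389–434 [Balaban1985BackgroundPropagators], (3.3) p. 390 and (3.8) p. 392 (the site-sector covariant derivatives `∇_{U,μ}`, `∇*_{U,μ}`), (3.23) p. 394 (the
# covariant Laplacian `Δ_U = Σ_μ ∇*∇`), (3.19) p. 393 and (3.24) p. 394 (`Δ′_a(U) = Δ_U + Σ_j a_j(L^jη)^{−2} Q′_j(U)* 1_{Λ_j} Q′_j(U)`, «Its inverse is denoted by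
# G′»), p. 396 («U′ = exp iηA′»), Thm 3.4 p. 400 («the operators G′(U) … extend to configurations U′U for α′₁ ≤ a₁ as analytic functions of A′» — whose first
# step is the analyticity of `Δ′_a(U′U)` itself), (3.62)–(3.64) p. 402; [Balaban1988RG2Cluster] (2.5) p. 12, p. 15: ★★ NODE 00's GENUINE COVARIANT OPERATOR
# `Δ′_a(U)` (`Node00.deltaPrimeAY i parSY U`, `Node00/OpsYDeltaPrimeA`, with the genuine transporter letter `parSY`) ALONG pv27's GROUP PENCIL: for every
# input field `Λ` and site `z`, `A′ ↦ (Δ′_a(e^{iηA′}U₀)Λ)(z)` is HOLOMORPHIC on every chart ball, with an explicit bound; the covariant site derivatives and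
# the Laplacian `Δ_U` (3.23) along the way.

statement-level complex analysis ([folklore]) AT NODE 00's `rfl`-level definitions (`UboxY shiftY cdS cdsS lapS cornerY levY avgCoeffY avgTrY
deltaPrimeAY`, consumed BY NAME with `deltaPrimeAY_apply`) over `B13OpsYPencilTransport` (the pencil's letters on the member torus, the taxicab transporter
`parSY` along the pencil: holomorphic, `≤ Kη^{tdist}`) and `B13TransportedLiftLetters` (`R_def`); kernel-checked; THEOREMS ONLY (no `def`, no `structure`,
no instance, no notation); NOTHING of NODE 00's ∕ pv27's is modified; nothing here is a claim about the Yang–Mills mass gap; no node is discharged;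
count-neutral.

WHY THIS FILE (cell `pub-ymgap`, HUMAN RULING D-0062 ∕ D-0149, Track A node N10 = [B13]; seat `pub-ymgap-dag-n10-c` g14, INTENT-7; census v16 item 1; the
N06 interface).  The inverse pieces of the N10 operator are `G′(U) = Δ′_a(U)⁻¹`, `G(U)`, `C(U)` (N06's Thm 3.4 ∕ 3.10 at the record; road 58 ∕ 58B: letters of
the inverse from letters of the operator at the CENTRE plus holomorphy of the OPERATOR along the chart).  THIS FILE supplies the operator side for `Δ′_a`:
NODE 00's `deltaPrimeAY = lapSL + kernelTrOpY avgCoeffY avgTrY` read along the pencil — the covariant site derivatives (§1), the covariant Laplacian (§2),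
the averaging transporter `avgTrY parSY U z w = U(Γ_{z,c})·U(Γ_{c,w})` through the block corner (§3, two taxicab transporters), and `Δ′_a` itself (§4) —
each holomorphic in `A′` for fixed input and output, with bounds in `Kη = K₀e^{|η|R}`, `‖Λ‖`, the dimension `d+1`, the averaging kernel and a
SUPPORT-LENGTH numeral `D` for the two-leg transport on the kernel's support (same block).

WHAT THIS FILE PROVES (all `theorem`s; `𝔸` NODE 00's complete normed `ℂ`-algebra, `‖1‖ = 1` for the bounds).
* §1 SITE DERIVATIVES: `cdS_apply ∕ cdsS_apply` (`rfl`: `(∇_{U,μ}Φ)(z) = R(U_μ(z))Φ(z+e_μ) − Φ(z)`, `(∇*_{U,μ}G)(z) = R(U_μ(z−e_μ))⁻¹ G(z−e_μ) − G(z)` on the box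
  chart), `differentiableOn_cdS_prodCfg ∕ differentiableOn_cdsS_prodCfg` (for an `A′`-DEPENDENT holomorphic input field), `norm_cdS_prodCfg_le ∕ norm_cdsS_prodCfg_le`
  (`≤ Kη·S·Kη + S` for inputs bounded by `S`).
* §2 ★ THE COVARIANT LAPLACIAN (3.23): `differentiableOn_lapS_prodCfg` (`A′ ↦ (Δ_{e^{iηA′}U₀}Λ)(z)` holomorphic for every `Λ`, `z`), `norm_lapS_prodCfg_le`
  (`≤ (d+1)·(Kη·S₁·Kη + S₁)`, `S₁ = Kη·‖Λ‖·Kη + ‖Λ‖`).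
* §3 THE AVERAGING TRANSPORT through the corner at `parSY`: `differentiableOn_avgTrY_prodCfg ∕ _inv_`, `norm_avgTrY_prodCfg_le ∕ _inv_` (`≤ Kη^{ℓ₁+ℓ₂}`, the two
  taxicab lengths).
* §4 ★★ `differentiableOn_deltaPrimeAY_prodCfg` — `A′ ↦ (Δ′_a(e^{iηA′}U₀)Λ)(z)` HOLOMORPHIC on every chart ball for every `Λ`, `z` (NODE 00's `deltaPrimeAY i (parSY i)`,
  via `deltaPrimeAY_apply`) —, ★★ `norm_deltaPrimeAY_prodCfg_le` (the §2 bound `+ (Σ_w |avgCoeff(z,w)|)·(Kη^D·‖Λ‖·Kη^D)` given the support-length numeral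
  `D`: `avgCoeff(z,w) ≠ 0 ⇒ ℓ₁ + ℓ₂ ≤ D`), and the N10 coordinates `differentiableOn_coord_deltaPrimeAY_prodCfg`.
HONEST FRAMING: NODE 00's DEFINITIONS read along pv27's DEFINITION; inputs are numerals (`K₀ ≥ 1`, `R`, `D`); Thm 3.4's content for `G′ = (Δ′_a)⁻¹` —
invertibility and the (3.62)–(3.64) Neumann step with ESTIMATES — is N06's and NOT here; N06 ∕ N10 NOT discharged; K1⁷ NOT closed; counts unmoved (typed
28∕28 · discharged 5∕27); no `sorry`, no new named fact; standard axioms; one finite 𝕋⁴ programme at fixed ε, Bałaban AS PRINTED; the YM mass gap (Clay) is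
NOT proved by any of this — R4 closes the conditional finite-𝕋⁴ rung `BalabanLadder.UV` only; nothing continuum ∕ ℝ⁴ ∕ OS.

References: T. Bałaban, CMP 99 (1985) 389–434 [Balaban1985BackgroundPropagators] (3.3) p.390, (3.8) p.392, (3.19) p.393, (3.23)–(3.24) p.394, (3.40)
p.397, Thm 3.4 p.400, (3.62)–(3.64) p.402; CMP 96 (1984) 223–250 [Balaban1984PropagatorsII] (2.13)–(2.14) p.225; CMP 116 (1988) 1–22 [Balaban1988RG2Cluster]
(2.5) p.12, p.15.
────────────────────────────────────────────────────────────────────────────────────────────────────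
v1.0.1 (docstring-only; declarations byte-identical): [B9] page locator corrected per the page owner (lit-balaban-r06 g64, 2026-08-28 03:26Z): display
(3.23) «Δ′_a(U) = D*_UD_U + Δ′(U) + Q′*(U)aQ′(U)» is p. 394 ((3.20)–(3.25) p. 394; p. 395 = (3.26)–(3.27)); six cite segments and the header re-paged, nothing
else touched.
-/

noncomputable section

namespace Literature.MathematicalPhysics.QuantumFieldTheory.Balaban1983to89.B13OpsYPencilDeltaPrime

open Metric Set Complex
open NormedSpace (exp)
open Literature.MathematicalPhysics.QuantumFieldTheory.Balaban1983to89
open Literature.MathematicalPhysics.QuantumFieldTheory.Balaban1983to89.B9Eq39Adjoint (R R_def prodCfg)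
open Literature.MathematicalPhysics.QuantumFieldTheory.Balaban1983to89.B6GlobalChartV1 (PV boxEquiv)
open Literature.MathematicalPhysics.QuantumFieldTheory.Balaban1983to89.B6KLevelCensusIndexV1 (KIdx)
open Literature.MathematicalPhysics.QuantumFieldTheory.Balaban1983to89.Node00
  (SiteY CfgY UboxY shiftY cdS cdsS lapS lapSL cornerY levY avgCoeffY avgTrY deltaPrimeAY deltaPrimeAY_apply parSY)
open Literature.MathematicalPhysics.QuantumFieldTheory.Balaban1983to89.B13OpsYPencilLetters
  (differentiableOn_prodCfg_apply differentiableOn_prodCfg_inv_apply norm_prodCfg_apply_le norm_prodCfg_inv_apply_le)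
open Literature.MathematicalPhysics.QuantumFieldTheory.Balaban1983to89.B13OpsYPencilTransport
  (differentiableOn_parSY_prodCfg differentiableOn_parSY_inv_prodCfg norm_parSY_prodCfg_le norm_parSY_inv_prodCfg_le)

variable {𝔸 : Type} [NormedRing 𝔸] [NormedAlgebra ℂ 𝔸] [CompleteSpace 𝔸]
variable {d ℓ : ℕ} {hd : 1 ≤ d + 1} {hL : Odd (ℓ + 1) ∧ 1 < ℓ + 1} {b₀ b₁ : ℝ}
variable (i : KIdx d ℓ hd hL b₀ b₁) (U₀ : CfgY 𝔸 i) (η : ℝ) {Rc K₀ S : ℝ}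

/-! ## §1. The site-sector covariant derivatives along the pencil -/

section SiteDerivatives

/-- **NODE 00's `∇_{U,μ}` on the box chart, UNFOLDED**: `(∇_{U,μ}Φ)(z) = R(U_μ(chart⁻¹ z))·Φ(z + e_μ) − Φ(z)` (definition `cdS := covD (shiftY) (UboxY U)`).
[cite: Balaban1985BackgroundPropagators, (3.3) p.390, (3.23) p.394] -/
theorem cdS_apply (U : CfgY 𝔸 i) (μ : Fin (d + 1)) (Φ : SiteY i → 𝔸) (z : SiteY i) :
    cdS i U μ Φ z = R (U μ ((boxEquiv i.hN).symm z)) (Φ (shiftY i μ z)) - Φ z := rfl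

/-- **NODE 00's `∇*_{U,μ}`, UNFOLDED**: `(∇*_{U,μ}G)(z) = R(U_μ(chart⁻¹(z − e_μ)))⁻¹·G(z − e_μ) − G(z)`. [cite: Balaban1985BackgroundPropagators, (3.8) p.392, (3.23) p.394] -/
theorem cdsS_apply (U : CfgY 𝔸 i) (μ : Fin (d + 1)) (G : SiteY i → 𝔸) (z : SiteY i) :
    cdsS i U μ G z = R (U μ ((boxEquiv i.hN).symm ((shiftY i μ).symm z)))⁻¹ (G ((shiftY i μ).symm z)) - G z := rfl

/-- `A′ ↦ (∇_{e^{iηA′}U₀,μ} Ψ(A′))(z)` is holomorphic for an `A′`-dependent input field holomorphic at every site.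
[cite: Balaban1985BackgroundPropagators, (3.3) p.390, Thm 3.4 p.400] -/
theorem differentiableOn_cdS_prodCfg {Ψ : (Fin (d + 1) → Site (PV d ℓ i.m i.K hd hL) 0 → 𝔸) → SiteY i → 𝔸}
    (hΨ : ∀ w, DifferentiableOn ℂ (fun a => Ψ a w) (ball 0 Rc)) (μ : Fin (d + 1)) (z : SiteY i) :
    DifferentiableOn ℂ (fun a => cdS i (prodCfg U₀ η a) μ (Ψ a) z) (ball (0 : Fin (d + 1) → Site (PV d ℓ i.m i.K hd hL) 0 → 𝔸) Rc) := by
  simp only [cdS_apply, R_def]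
  exact (((differentiableOn_prodCfg_apply i U₀ η μ _).mul (hΨ _)).mul (differentiableOn_prodCfg_inv_apply i U₀ η μ _)).sub (hΨ z)

/-- `A′ ↦ (∇*_{e^{iηA′}U₀,μ} Ψ(A′))(z)` is holomorphic for an `A′`-dependent holomorphic input. [cite: Balaban1985BackgroundPropagators, (3.8) p.392, Thm 3.4 p.400] -/
theorem differentiableOn_cdsS_prodCfg {Ψ : (Fin (d + 1) → Site (PV d ℓ i.m i.K hd hL) 0 → 𝔸) → SiteY i → 𝔸}
    (hΨ : ∀ w, DifferentiableOn ℂ (fun a => Ψ a w) (ball 0 Rc)) (μ : Fin (d + 1)) (z : SiteY i) :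
    DifferentiableOn ℂ (fun a => cdsS i (prodCfg U₀ η a) μ (Ψ a) z) (ball (0 : Fin (d + 1) → Site (PV d ℓ i.m i.K hd hL) 0 → 𝔸) Rc) := by
  simp only [cdsS_apply, R_def, inv_inv]
  exact (((differentiableOn_prodCfg_inv_apply i U₀ η μ _).mul (hΨ _)).mul (differentiableOn_prodCfg_apply i U₀ η μ _)).sub (hΨ z)

variable [NormOneClass 𝔸]

omit [NormedAlgebra ℂ 𝔸] [CompleteSpace 𝔸] [NormOneClass 𝔸] in
/-- `‖V·x·W − y‖ ≤ K·S·K + S` from `‖V‖, ‖W‖ ≤ K`, `‖x‖, ‖y‖ ≤ S` (plumbing). [folklore] -/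
private theorem norm_conj_sub_le {V x W y : 𝔸} {K S : ℝ} (hV : ‖V‖ ≤ K) (hx : ‖x‖ ≤ S) (hW : ‖W‖ ≤ K) (hy : ‖y‖ ≤ S) :
    ‖V * x * W - y‖ ≤ K * S * K + S := by
  have h0 : 0 ≤ K := (norm_nonneg _).trans hV
  have h1 : 0 ≤ S := (norm_nonneg _).trans hx
  refine (norm_sub_le _ _).trans (add_le_add ?_ hy)
  calc ‖V * x * W‖ ≤ ‖V * x‖ * ‖W‖ := norm_mul_le _ _
    _ ≤ K * S * K := mul_le_mul ((norm_mul_le _ _).trans (mul_le_mul hV hx (norm_nonneg _) h0)) hW (norm_nonneg _)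
        (mul_nonneg h0 h1)

/-- On `‖A′‖ < R`: `‖(∇_{U,μ}Ψ(A′))(z)‖ ≤ Kη·S·Kη + S` when `‖Ψ(A′)(w)‖ ≤ S` on the ball, `‖U₀(b)^{±1}‖ ≤ K₀`.
[cite: Balaban1985BackgroundPropagators, (3.3) p.390, (3.35)–(3.37) p.396] -/
theorem norm_cdS_prodCfg_le (hU : ∀ μ x, ‖(U₀ μ x : 𝔸)‖ ≤ K₀) (hUi : ∀ μ x, ‖(((U₀ μ x)⁻¹ : 𝔸ˣ) : 𝔸)‖ ≤ K₀) (hRc : 0 ≤ Rc)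
    {Ψ : (Fin (d + 1) → Site (PV d ℓ i.m i.K hd hL) 0 → 𝔸) → SiteY i → 𝔸}
    (hS : ∀ a ∈ ball (0 : Fin (d + 1) → Site (PV d ℓ i.m i.K hd hL) 0 → 𝔸) Rc, ∀ w, ‖Ψ a w‖ ≤ S)
    {a : Fin (d + 1) → Site (PV d ℓ i.m i.K hd hL) 0 → 𝔸} (ha : a ∈ ball 0 Rc) (μ : Fin (d + 1)) (z : SiteY i) :
    ‖cdS i (prodCfg U₀ η a) μ (Ψ a) z‖ ≤ K₀ * Real.exp (|η| * Rc) * S * (K₀ * Real.exp (|η| * Rc)) + S := by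
  rw [cdS_apply, R_def]
  exact norm_conj_sub_le (norm_prodCfg_apply_le i U₀ η hU hRc a ha μ _) (hS a ha _) (norm_prodCfg_inv_apply_le i U₀ η hUi hRc a ha μ _)
    (hS a ha z)

/-- On `‖A′‖ < R`: `‖(∇*_{U,μ}Ψ(A′))(z)‖ ≤ Kη·S·Kη + S`. [cite: Balaban1985BackgroundPropagators, (3.8) p.392, (3.35)–(3.37) p.396] -/
theorem norm_cdsS_prodCfg_le (hU : ∀ μ x, ‖(U₀ μ x : 𝔸)‖ ≤ K₀) (hUi : ∀ μ x, ‖(((U₀ μ x)⁻¹ : 𝔸ˣ) : 𝔸)‖ ≤ K₀) (hRc : 0 ≤ Rc)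
    {Ψ : (Fin (d + 1) → Site (PV d ℓ i.m i.K hd hL) 0 → 𝔸) → SiteY i → 𝔸}
    (hS : ∀ a ∈ ball (0 : Fin (d + 1) → Site (PV d ℓ i.m i.K hd hL) 0 → 𝔸) Rc, ∀ w, ‖Ψ a w‖ ≤ S)
    {a : Fin (d + 1) → Site (PV d ℓ i.m i.K hd hL) 0 → 𝔸} (ha : a ∈ ball 0 Rc) (μ : Fin (d + 1)) (z : SiteY i) :
    ‖cdsS i (prodCfg U₀ η a) μ (Ψ a) z‖ ≤ K₀ * Real.exp (|η| * Rc) * S * (K₀ * Real.exp (|η| * Rc)) + S := by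
  rw [cdsS_apply, R_def, inv_inv]
  exact norm_conj_sub_le (norm_prodCfg_inv_apply_le i U₀ η hUi hRc a ha μ _) (hS a ha _) (norm_prodCfg_apply_le i U₀ η hU hRc a ha μ _)
    (hS a ha z)

end SiteDerivatives

/-! ## §2. ★ The covariant Laplacian `Δ_U` (3.23) along the pencil -/

section Laplacian

omit [CompleteSpace 𝔸] in
/-- NODE 00's `Δ_U`, unfolded at a site: `(Δ_UΛ)(z) = Σ_μ (∇*_{U,μ}(∇_{U,μ}Λ))(z)`. [cite: Balaban1985BackgroundPropagators, (3.23) p.394] -/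
theorem lapS_apply [CompleteSpace 𝔸] (U : CfgY 𝔸 i) (Λ : SiteY i → 𝔸) (z : SiteY i) :
    lapS i U Λ z = ∑ μ : Fin (d + 1), cdsS i U μ (cdS i U μ Λ) z := rfl

/-- ★ **`A′ ↦ (Δ_{e^{iηA′}U₀}Λ)(z)` IS HOLOMORPHIC** on every chart ball, for every field `Λ` and site `z`.
[cite: Balaban1985BackgroundPropagators, (3.23) p.394, Thm 3.4 and (3.50) p.400] -/
theorem differentiableOn_lapS_prodCfg (Λ : SiteY i → 𝔸) (z : SiteY i) :
    DifferentiableOn ℂ (fun a => lapS i (prodCfg U₀ η a) Λ z) (ball (0 : Fin (d + 1) → Site (PV d ℓ i.m i.K hd hL) 0 → 𝔸) Rc) := by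
  simp only [lapS_apply]
  refine DifferentiableOn.fun_sum fun μ _ => ?_
  exact differentiableOn_cdsS_prodCfg i U₀ η (Ψ := fun a => cdS i (prodCfg U₀ η a) μ Λ)
    (fun w => differentiableOn_cdS_prodCfg i U₀ η (Ψ := fun _ => Λ) (fun _ => differentiableOn_const _) μ w) μ z

variable [NormOneClass 𝔸]

/-- ★ **… WITH THE BOUND** `‖(Δ_UΛ)(z)‖ ≤ (d+1)·(Kη·S₁·Kη + S₁)`, `S₁ = Kη·‖Λ‖·Kη + ‖Λ‖`, on `‖A′‖ < R`.
[cite: Balaban1985BackgroundPropagators, (3.23) p.394, Thm 3.4 p.400] -/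
theorem norm_lapS_prodCfg_le (hU : ∀ μ x, ‖(U₀ μ x : 𝔸)‖ ≤ K₀) (hUi : ∀ μ x, ‖(((U₀ μ x)⁻¹ : 𝔸ˣ) : 𝔸)‖ ≤ K₀) (hRc : 0 ≤ Rc)
    (Λ : SiteY i → 𝔸) {a : Fin (d + 1) → Site (PV d ℓ i.m i.K hd hL) 0 → 𝔸} (ha : a ∈ ball 0 Rc) (z : SiteY i) :
    ‖lapS i (prodCfg U₀ η a) Λ z‖ ≤ ((d : ℝ) + 1) *
      (K₀ * Real.exp (|η| * Rc) * (K₀ * Real.exp (|η| * Rc) * ‖Λ‖ * (K₀ * Real.exp (|η| * Rc)) + ‖Λ‖) * (K₀ * Real.exp (|η| * Rc)) +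
        (K₀ * Real.exp (|η| * Rc) * ‖Λ‖ * (K₀ * Real.exp (|η| * Rc)) + ‖Λ‖)) := by
  rw [lapS_apply]
  refine (norm_sum_le _ _).trans ?_
  have h : ∀ μ ∈ (Finset.univ : Finset (Fin (d + 1))), ‖cdsS i (prodCfg U₀ η a) μ (cdS i (prodCfg U₀ η a) μ Λ) z‖ ≤
      K₀ * Real.exp (|η| * Rc) * (K₀ * Real.exp (|η| * Rc) * ‖Λ‖ * (K₀ * Real.exp (|η| * Rc)) + ‖Λ‖) * (K₀ * Real.exp (|η| * Rc)) +
        (K₀ * Real.exp (|η| * Rc) * ‖Λ‖ * (K₀ * Real.exp (|η| * Rc)) + ‖Λ‖) :=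
    fun μ _ => norm_cdsS_prodCfg_le i U₀ η hU hUi hRc (Ψ := fun a => cdS i (prodCfg U₀ η a) μ Λ)
      (fun a ha w => norm_cdS_prodCfg_le i U₀ η hU hUi hRc (Ψ := fun _ => Λ) (fun _ _ w => norm_le_pi_norm Λ w) ha μ w) ha μ z
  refine (Finset.sum_le_sum h).trans (le_of_eq ?_)
  rw [Finset.sum_const, Finset.card_univ, Fintype.card_fin, nsmul_eq_mul, Nat.cast_add, Nat.cast_one]

end Laplacian

/-! ## §3. The averaging transporter through the block corner, at `parSY`, along the pencil -/

section AvgTransport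

omit [CompleteSpace 𝔸] in
/-- NODE 00's averaging transporter at a transporter letter, unfolded: `U(Γ_{z,c})·U(Γ_{c,w})`, `c` the corner of `z`'s block. [cite: Balaban1985BackgroundPropagators, (3.19) p.393, (3.24) p.394] -/
theorem val_avgTrY [CompleteSpace 𝔸] (par : Node00.SiteParY 𝔸 i) (U : CfgY 𝔸 i) (z w : SiteY i) :
    (avgTrY i par U z w : 𝔸) = (par U z (cornerY i (levY i z) z) : 𝔸) * (par U (cornerY i (levY i z) z) w : 𝔸) := by
  rw [avgTrY, Units.val_mul]

omit [CompleteSpace 𝔸] in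
/-- … and its inverse `U(Γ_{c,w})⁻¹·U(Γ_{z,c})⁻¹`. [cite: Balaban1985BackgroundPropagators, (3.19) p.393, (3.5) p.391] -/
theorem val_inv_avgTrY [CompleteSpace 𝔸] (par : Node00.SiteParY 𝔸 i) (U : CfgY 𝔸 i) (z w : SiteY i) :
    (((avgTrY i par U z w)⁻¹ : 𝔸ˣ) : 𝔸) =
      (((par U (cornerY i (levY i z) z) w)⁻¹ : 𝔸ˣ) : 𝔸) * (((par U z (cornerY i (levY i z) z))⁻¹ : 𝔸ˣ) : 𝔸) := by
  rw [avgTrY, mul_inv_rev, Units.val_mul]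

/-- `A′ ↦ avgTrY parSY (e^{iηA′}U₀) z w` is holomorphic on every ball. [cite: Balaban1985BackgroundPropagators, (3.19) p.393, (3.24) p.394, Thm 3.4 p.400] -/
theorem differentiableOn_avgTrY_prodCfg (z w : SiteY i) :
    DifferentiableOn ℂ (fun a => (avgTrY i (parSY i) (prodCfg U₀ η a) z w : 𝔸)) (ball (0 : Fin (d + 1) → Site (PV d ℓ i.m i.K hd hL) 0 → 𝔸) Rc) := by
  simp only [val_avgTrY]
  exact (differentiableOn_parSY_prodCfg i U₀ η z _).mul (differentiableOn_parSY_prodCfg i U₀ η _ w)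

/-- … and so is its inverse. [cite: Balaban1985BackgroundPropagators, (3.19) p.393, (3.5) p.391, Thm 3.4 p.400] -/
theorem differentiableOn_avgTrY_inv_prodCfg (z w : SiteY i) :
    DifferentiableOn ℂ (fun a => (((avgTrY i (parSY i) (prodCfg U₀ η a) z w)⁻¹ : 𝔸ˣ) : 𝔸))
      (ball (0 : Fin (d + 1) → Site (PV d ℓ i.m i.K hd hL) 0 → 𝔸) Rc) := by
  simp only [val_inv_avgTrY]
  exact (differentiableOn_parSY_inv_prodCfg i U₀ η _ w).mul (differentiableOn_parSY_inv_prodCfg i U₀ η z _)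

variable [NormOneClass 𝔸]

/-- On `‖A′‖ < R`: `‖avgTrY parSY (e^{iηA′}U₀) z w‖ ≤ Kη^{ℓ₁} · Kη^{ℓ₂}`, `ℓ₁, ℓ₂` the taxicab lengths `z → c`, `c → w` (through the box chart).
[cite: Balaban1985BackgroundPropagators, (3.19) p.393, (3.40) p.397, (3.35)–(3.37) p.396] -/
theorem norm_avgTrY_prodCfg_le (hU : ∀ μ x, ‖(U₀ μ x : 𝔸)‖ ≤ K₀) (hUi : ∀ μ x, ‖(((U₀ μ x)⁻¹ : 𝔸ˣ) : 𝔸)‖ ≤ K₀) (hRc : 0 ≤ Rc)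
    {a : Fin (d + 1) → Site (PV d ℓ i.m i.K hd hL) 0 → 𝔸} (ha : a ∈ ball 0 Rc) (z w : SiteY i) :
    ‖(avgTrY i (parSY i) (prodCfg U₀ η a) z w : 𝔸)‖ ≤
      (K₀ * Real.exp (|η| * Rc)) ^ Site.tdist ((boxEquiv i.hN).symm z) ((boxEquiv i.hN).symm (cornerY i (levY i z) z)) *
        (K₀ * Real.exp (|η| * Rc)) ^ Site.tdist ((boxEquiv i.hN).symm (cornerY i (levY i z) z)) ((boxEquiv i.hN).symm w) := by
  rw [val_avgTrY]
  have h1 := norm_parSY_prodCfg_le i U₀ η hU hUi hRc ha z (cornerY i (levY i z) z)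
  have h2 := norm_parSY_prodCfg_le i U₀ η hU hUi hRc ha (cornerY i (levY i z) z) w
  exact (norm_mul_le _ _).trans (mul_le_mul h1 h2 (norm_nonneg _) ((norm_nonneg _).trans h1))

/-- On `‖A′‖ < R`: `‖(avgTrY parSY (e^{iηA′}U₀) z w)⁻¹‖ ≤ Kη^{ℓ₂} · Kη^{ℓ₁}`. [cite: Balaban1985BackgroundPropagators, (3.19) p.393, (3.5) p.391, (3.40) p.397] -/
theorem norm_avgTrY_inv_prodCfg_le (hU : ∀ μ x, ‖(U₀ μ x : 𝔸)‖ ≤ K₀) (hUi : ∀ μ x, ‖(((U₀ μ x)⁻¹ : 𝔸ˣ) : 𝔸)‖ ≤ K₀) (hRc : 0 ≤ Rc)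
    {a : Fin (d + 1) → Site (PV d ℓ i.m i.K hd hL) 0 → 𝔸} (ha : a ∈ ball 0 Rc) (z w : SiteY i) :
    ‖(((avgTrY i (parSY i) (prodCfg U₀ η a) z w)⁻¹ : 𝔸ˣ) : 𝔸)‖ ≤
      (K₀ * Real.exp (|η| * Rc)) ^ Site.tdist ((boxEquiv i.hN).symm (cornerY i (levY i z) z)) ((boxEquiv i.hN).symm w) *
        (K₀ * Real.exp (|η| * Rc)) ^ Site.tdist ((boxEquiv i.hN).symm z) ((boxEquiv i.hN).symm (cornerY i (levY i z) z)) := by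
  rw [val_inv_avgTrY]
  have h1 := norm_parSY_inv_prodCfg_le i U₀ η hU hUi hRc ha (cornerY i (levY i z) z) w
  have h2 := norm_parSY_inv_prodCfg_le i U₀ η hU hUi hRc ha z (cornerY i (levY i z) z)
  exact (norm_mul_le _ _).trans (mul_le_mul h1 h2 (norm_nonneg _) ((norm_nonneg _).trans h1))

end AvgTransport

/-! ## §4. ★★ `Δ′_a(U)` (3.24) along the pencil -/

section DeltaPrime

/-- ★★ **`A′ ↦ (Δ′_a(e^{iηA′}U₀)Λ)(z)` IS HOLOMORPHIC** on every chart ball, for every field `Λ` and site `z` — NODE 00's genuine covariant operator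
`deltaPrimeAY i (parSY i)` of (3.24) (covariant Laplacian + transported averaging kernel), the operator whose inverse is `G′`: the analyticity of the
OPERATOR along the chart that Thm 3.4's extension of `G′(U′U)` starts from. [cite: Balaban1985BackgroundPropagators, (3.24) p.394, Thm 3.4 p.400, (3.62)–(3.64) p.402] -/
theorem differentiableOn_deltaPrimeAY_prodCfg (Λ : SiteY i → 𝔸) (z : SiteY i) :
    DifferentiableOn ℂ (fun a => deltaPrimeAY i (parSY i) (prodCfg U₀ η a) Λ z) (ball (0 : Fin (d + 1) → Site (PV d ℓ i.m i.K hd hL) 0 → 𝔸) Rc) := by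
  simp only [deltaPrimeAY_apply, R_def]
  refine (differentiableOn_lapS_prodCfg i U₀ η Λ z).add (DifferentiableOn.fun_sum fun w _ => ?_)
  exact (((differentiableOn_avgTrY_prodCfg i U₀ η z w).mul (differentiableOn_const _)).mul
    (differentiableOn_avgTrY_inv_prodCfg i U₀ η z w)).const_smul (((avgCoeffY i z w : ℝ) : ℂ))

/-- ★ **THE N10 COORDINATES OF `Δ′_a` ALONG THE PENCIL ARE HOLOMORPHIC**: `A′ ↦ φ_k((Δ′_a(e^{iηA′}U₀)(δ_x ⊗ e_l))(z))`.
[cite: Balaban1985BackgroundPropagators, (3.24) p.394, Thm 3.4 p.400; Balaban1988RG2Cluster, (2.5) p.12, p.15] -/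
theorem differentiableOn_coord_deltaPrimeAY_prodCfg [DecidableEq (SiteY i)] {κ : Type} (φ : κ → 𝔸 →L[ℂ] ℂ) (e : κ → 𝔸) (z x : SiteY i) (k l : κ) :
    DifferentiableOn ℂ (fun a => φ k (deltaPrimeAY i (parSY i) (prodCfg U₀ η a) (Pi.single x (e l)) z))
      (ball (0 : Fin (d + 1) → Site (PV d ℓ i.m i.K hd hL) 0 → 𝔸) Rc) :=
  (φ k).differentiable.comp_differentiableOn (differentiableOn_deltaPrimeAY_prodCfg i U₀ η (Pi.single x (e l)) z)

variable [NormOneClass 𝔸] {D : ℕ}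

/-- ★★ **… WITH THE BOUND** on `‖A′‖ < R`: `‖(Δ′_a(e^{iηA′}U₀)Λ)(z)‖ ≤ [§2's Laplacian majorant] + (Σ_w |avgCoeff(z,w)|)·(Kη^D·‖Λ‖·Kη^D)`, given
`‖U₀(b)^{±1}‖ ≤ K₀`, `1 ≤ K₀` and the SUPPORT-LENGTH numeral `D` (`avgCoeff(z,w) ≠ 0 ⇒ ℓ₁ + ℓ₂ ≤ D`: both legs inside the common block).
[cite: Balaban1985BackgroundPropagators, (3.24) p.394, (3.40) p.397, Thm 3.4 p.400, (3.108) p.416] -/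
theorem norm_deltaPrimeAY_prodCfg_le (hU : ∀ μ x, ‖(U₀ μ x : 𝔸)‖ ≤ K₀) (hUi : ∀ μ x, ‖(((U₀ μ x)⁻¹ : 𝔸ˣ) : 𝔸)‖ ≤ K₀) (hK1 : 1 ≤ K₀)
    (hRc : 0 ≤ Rc)
    (hD : ∀ z w, avgCoeffY i z w ≠ 0 →
      Site.tdist ((boxEquiv i.hN).symm z) ((boxEquiv i.hN).symm (cornerY i (levY i z) z)) +
        Site.tdist ((boxEquiv i.hN).symm (cornerY i (levY i z) z)) ((boxEquiv i.hN).symm w) ≤ D)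
    (Λ : SiteY i → 𝔸) {a : Fin (d + 1) → Site (PV d ℓ i.m i.K hd hL) 0 → 𝔸} (ha : a ∈ ball 0 Rc) (z : SiteY i) :
    ‖deltaPrimeAY i (parSY i) (prodCfg U₀ η a) Λ z‖ ≤
      ((d : ℝ) + 1) *
        (K₀ * Real.exp (|η| * Rc) * (K₀ * Real.exp (|η| * Rc) * ‖Λ‖ * (K₀ * Real.exp (|η| * Rc)) + ‖Λ‖) * (K₀ * Real.exp (|η| * Rc)) +
          (K₀ * Real.exp (|η| * Rc) * ‖Λ‖ * (K₀ * Real.exp (|η| * Rc)) + ‖Λ‖)) +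
      (∑ w, |avgCoeffY i z w|) * ((K₀ * Real.exp (|η| * Rc)) ^ D * ‖Λ‖ * (K₀ * Real.exp (|η| * Rc)) ^ D) := by
  set Kη : ℝ := K₀ * Real.exp (|η| * Rc) with hKη
  have h1 : (1 : ℝ) ≤ Kη := one_le_mul_of_one_le_of_one_le hK1 (Real.one_le_exp (mul_nonneg (abs_nonneg _) hRc))
  have h0 : (0 : ℝ) ≤ Kη := zero_le_one.trans h1
  rw [deltaPrimeAY_apply]
  refine (norm_add_le _ _).trans (add_le_add (norm_lapS_prodCfg_le i U₀ η hU hUi hRc Λ ha z) ?_)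
  rw [Finset.sum_mul]
  refine (norm_sum_le _ _).trans (Finset.sum_le_sum fun w _ => ?_)
  rw [norm_smul, Complex.norm_real, Real.norm_eq_abs]
  by_cases hc : avgCoeffY i z w = 0
  · rw [hc, abs_zero, zero_mul, zero_mul]
  refine mul_le_mul_of_nonneg_left ?_ (abs_nonneg _)
  rw [R_def]
  have hsum := hD z w hc
  have hV : ‖(avgTrY i (parSY i) (prodCfg U₀ η a) z w : 𝔸)‖ ≤ Kη ^ D := by
    refine (norm_avgTrY_prodCfg_le i U₀ η hU hUi hRc ha z w).trans ?_
    rw [← pow_add]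
    exact pow_le_pow_right₀ h1 hsum
  have hVi : ‖(((avgTrY i (parSY i) (prodCfg U₀ η a) z w)⁻¹ : 𝔸ˣ) : 𝔸)‖ ≤ Kη ^ D := by
    refine (norm_avgTrY_inv_prodCfg_le i U₀ η hU hUi hRc ha z w).trans ?_
    rw [← pow_add, add_comm]
    exact pow_le_pow_right₀ h1 hsum
  calc ‖(avgTrY i (parSY i) (prodCfg U₀ η a) z w : 𝔸) * Λ w * (((avgTrY i (parSY i) (prodCfg U₀ η a) z w)⁻¹ : 𝔸ˣ) : 𝔸)‖
      ≤ ‖(avgTrY i (parSY i) (prodCfg U₀ η a) z w : 𝔸) * Λ w‖ * ‖(((avgTrY i (parSY i) (prodCfg U₀ η a) z w)⁻¹ : 𝔸ˣ) : 𝔸)‖ :=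
        norm_mul_le _ _
    _ ≤ Kη ^ D * ‖Λ‖ * Kη ^ D :=
        mul_le_mul ((norm_mul_le _ _).trans (mul_le_mul hV (norm_le_pi_norm Λ w) (norm_nonneg _) (pow_nonneg h0 D))) hVi
          (norm_nonneg _) (mul_nonneg (pow_nonneg h0 D) (norm_nonneg _))

end DeltaPrime

end Literature.MathematicalPhysics.QuantumFieldTheory.Balaban1983to89.B13OpsYPencilDeltaPrime

end
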